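import Mathlib
import Summits.KontsevichZagierPeriods.Zeta5Search.DualSeriesDecomposition
import HarnessLib

/-!
# The dual very-well-poised series `F̃₇(b)`: Lemma 1 of the wedge dictionary (contiguity), PROVED

Cell `pub-zeta5` (HONEST FRAMING: systematic search; no irrationality claim unless certified), typer seat,
generation 3.  OUR work (Summit side).  LEMMA 1 of the cell's wedge-square dictionary for the Brown–Zudilin
cellular family (found by the planner seats gen-1/gen-2, `run/shared/lean/pub/pub-zeta5/pub-zeta5-gen-1/DICTIONARY.md`
§1, proved there on paper termwise; the termwise Gamma-function version was also staged in Lean by gen-1):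
for integer `b` with `0 ≤ b₀`, `0 ≤ b_j ≤ b₀` (`j = 1,…,7`) and `Σ_j b_j ≤ 3b₀`,

  `F̃₇(b + e_j) − F̃₇(b + e_k) = (b_j − b_k)(b₀ − b_j − b_k) · F̃₇(b)`     (`vwpDual_seven_contiguity'`),

where `F̃₇ = Literature…BrownZudilin2022.vwpDual 7` is the series (34) of arXiv:2210.03391.  Proof: on the
polynomial form of `DualSeriesDecomposition.lean`, `numPoly_{b+e_j} = (X + b_j)(X + b₀ − b_j) · numPoly_b`
(`numPoly_update`), so `term (b+e_j) μ = (μ+1+b_j)(μ+1+b₀−b_j) · term b μ` (`term_update`) and the `μ`-dependence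
cancels in the difference; the two shifted series converge by `summable_term` (this is where `Σ_j b_j ≤ 3b₀`,
i.e. `d(b) ≥ 0`, enters).  Consequence used by the dictionary: the multiplier `ρ` is partner-independent.
-/

noncomputable section

open Finset Polynomial

namespace Summit.KontsevichZagierPeriods.Zeta5Search.DualSeries

open Literature.NumberTheory.Irrationality.BrownZudilin2022 (vwpDual)
open Literature.NumberTheory.Transcendental.BallRivoal (pochPoly)

/-! ### Lemma 1 of the wedge dictionary (contiguity), PROVED -/

/-- `(X)_{n+1} = (X)_n · (X + n)`. -/
theorem pochPoly_zero_succ (n : ℕ) : pochPoly 0 (n + 1) = pochPoly 0 n * (X + C (n : ℚ)) := by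
  unfold pochPoly
  rw [prod_range_succ, zero_add]

/-- `(X+β)_{n+1} = (X + β) · (X+β+1)_n`. -/
theorem pochPoly_succ_left (β : ℚ) (n : ℕ) : pochPoly β (n + 1) = (X + C β) * pochPoly (β + 1) n := by
  unfold pochPoly
  rw [prod_range_succ', mul_comm]
  congr 1
  · rw [Nat.cast_zero, add_zero]
  · refine prod_congr rfl fun s _ => ?_
    push_cast
    ring_nf

/-- Raising `b_{i+1}` by one multiplies the numerator polynomial by `(X + b_{i+1})(X + b₀ − b_{i+1})`. -/
theorem numPoly_update (b : ℕ → ℤ) {i : ℕ} (hi : i ∈ range 7) (hbi : 0 ≤ b (i + 1)) :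
    numPoly (Function.update b (i + 1) (b (i + 1) + 1)) =
      numPoly b * ((X + C (b (i + 1) : ℚ)) * (X + C ((b 0 - b (i + 1) : ℤ) : ℚ))) := by
  have h0 : Function.update b (i + 1) (b (i + 1) + 1) 0 = b 0 := Function.update_of_ne (by omega) _ _
  have hn : (b (i + 1) + 1).toNat = (b (i + 1)).toNat + 1 := by omega
  have hcast : (((b (i + 1)).toNat : ℕ) : ℚ) = (b (i + 1) : ℚ) := by exact_mod_cast Int.toNat_of_nonneg hbi
  unfold numPoly
  rw [h0, ← mul_prod_erase (range 7) _ hi, ← mul_prod_erase (range 7) (fun j => pochPoly 0 (b (j + 1)).toNat *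
      pochPoly ((b 0 - b (j + 1) + 1 : ℤ) : ℚ) (b (j + 1)).toNat) hi]
  have hrest : ∏ j ∈ (range 7).erase i,
      pochPoly 0 (Function.update b (i + 1) (b (i + 1) + 1) (j + 1)).toNat *
        pochPoly ((b 0 - Function.update b (i + 1) (b (i + 1) + 1) (j + 1) + 1 : ℤ) : ℚ)
          (Function.update b (i + 1) (b (i + 1) + 1) (j + 1)).toNat =
      ∏ j ∈ (range 7).erase i, (pochPoly 0 (b (j + 1)).toNat *
        pochPoly ((b 0 - b (j + 1) + 1 : ℤ) : ℚ) (b (j + 1)).toNat) := by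
    refine prod_congr rfl fun j hj => ?_
    have hne : j + 1 ≠ i + 1 := by have := (mem_erase.1 hj).1; omega
    rw [Function.update_of_ne hne]
  rw [hrest, Function.update_self, hn, pochPoly_zero_succ, pochPoly_succ_left, hcast]
  have e1 : ((b 0 - (b (i + 1) + 1) + 1 : ℤ) : ℚ) = ((b 0 - b (i + 1) : ℤ) : ℚ) := by push_cast; ring
  have e2 : ((b 0 - (b (i + 1) + 1) + 1 : ℤ) : ℚ) + 1 = ((b 0 - b (i + 1) + 1 : ℤ) : ℚ) := by push_cast; ring
  rw [e2, e1]
  ring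

/-- The box is stable under `b_{i+1} ↦ b_{i+1} + 1` as long as `b_{i+1} ≤ b₀`. -/
theorem inBox_update (b : ℕ → ℤ) (hb : InBox b) {i : ℕ} (hi : i ∈ range 7) (hbi : b (i + 1) ≤ b 0) :
    InBox (Function.update b (i + 1) (b (i + 1) + 1)) := by
  obtain ⟨h0, hj⟩ := hb
  refine ⟨by rw [Function.update_of_ne (by omega)]; exact h0, fun j hj' => ?_⟩
  rw [Function.update_of_ne (show (0 : ℕ) ≠ i + 1 by omega)]
  by_cases hji : j = i
  · subst hji
    rw [Function.update_self]
    have := (hj j hi).1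
    exact ⟨by omega, by omega⟩
  · rw [Function.update_of_ne (show j + 1 ≠ i + 1 by omega)]
    exact hj j hj'

/-- The parameter sum goes up by one under `b_{i+1} ↦ b_{i+1} + 1`. -/
theorem sum_update (b : ℕ → ℤ) {i : ℕ} (hi : i ∈ range 7) :
    ∑ j ∈ range 7, Function.update b (i + 1) (b (i + 1) + 1) (j + 1) = (∑ j ∈ range 7, b (j + 1)) + 1 := by
  rw [← add_sum_erase (range 7) _ hi, ← add_sum_erase (range 7) (fun j => b (j + 1)) hi, Function.update_self]
  have hrest : ∑ j ∈ (range 7).erase i, Function.update b (i + 1) (b (i + 1) + 1) (j + 1) =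
      ∑ j ∈ (range 7).erase i, b (j + 1) := by
    refine sum_congr rfl fun j hj => ?_
    have hne : j + 1 ≠ i + 1 := by have := (mem_erase.1 hj).1; omega
    rw [Function.update_of_ne hne]
  rw [hrest]
  ring

/-- LEMMA 1, termwise: `term (b + e_{i+1}) μ = (μ + 1 + b_{i+1})(μ + 1 + b₀ − b_{i+1}) · term b μ`. -/
theorem term_update (b : ℕ → ℤ) (hb : InBox b) {i : ℕ} (hi : i ∈ range 7) (hbi : b (i + 1) ≤ b 0) (μ : ℕ) :
    term (Function.update b (i + 1) (b (i + 1) + 1)) μ =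
      (((μ : ℝ) + 1 + b (i + 1)) * ((μ : ℝ) + 1 + (b 0 - b (i + 1)))) * term b μ := by
  have h0 : Function.update b (i + 1) (b (i + 1) + 1) 0 = b 0 := Function.update_of_ne (by omega) _ _
  rw [term_eq _ (inBox_update b hb hi hbi), term_eq _ hb, h0, numPoly_update b hi (hb.2 i hi).1, map_mul,
    map_mul, map_add, map_add, aeval_X, aeval_C, aeval_C, eq_ratCast, eq_ratCast]
  push_cast
  ring

/-- LEMMA 1 (CONTIGUITY) of the cell's wedge dictionary, PROVED: for integer `b` with `0 ≤ b₀`,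
`0 ≤ b_j ≤ b₀` (`j = 1,…,7`) and `Σ_j b_j ≤ 3b₀`,
`F̃₇(b + e_i) − F̃₇(b + e_k) = (b_i − b_k)(b₀ − b_i − b_k) · F̃₇(b)` (indices written `i+1`, `k+1` with
`i, k < 7`). The `μ`-dependence cancels termwise (`term_update`); the two shifted series converge by
`summable_term`. -/
theorem vwpDual_seven_contiguity (b : ℕ → ℤ) (h0 : 0 ≤ b 0)
    (hb : ∀ j ∈ range 7, 0 ≤ b (j + 1) ∧ b (j + 1) ≤ b 0) (hsum : ∑ j ∈ range 7, b (j + 1) ≤ 3 * b 0)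
    {i k : ℕ} (hi : i ∈ range 7) (hk : k ∈ range 7) :
    vwpDual 7 (Function.update b (i + 1) (b (i + 1) + 1)) -
        vwpDual 7 (Function.update b (k + 1) (b (k + 1) + 1)) =
      (((b (i + 1) - b (k + 1)) * (b 0 - b (i + 1) - b (k + 1)) : ℤ) : ℝ) * vwpDual 7 b := by
  have hbox : InBox b := ⟨h0, fun j hj => ⟨(hb j hj).1, by linarith [(hb j hj).2]⟩⟩
  have hS : ∀ {l : ℕ}, l ∈ range 7 → Summable (term (Function.update b (l + 1) (b (l + 1) + 1))) :=
    fun {l} hl => summable_term _ (inBox_update b hbox hl (hb l hl).2) (by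
      rw [sum_update b hl, Function.update_of_ne (show (0 : ℕ) ≠ l + 1 by omega)]
      linarith)
  rw [vwpDual_seven_eq_tsum, vwpDual_seven_eq_tsum, vwpDual_seven_eq_tsum, ← (hS hi).tsum_sub (hS hk),
    ← tsum_mul_left]
  congr 1
  funext μ
  rw [term_update b hbox hi (hb i hi).2 μ, term_update b hbox hk (hb k hk).2 μ]
  push_cast
  ring

/-- The same with indices `j, k ∈ [1, 7]` and the shift written `b + e_j = Function.update b j (b j + 1)`. -/
theorem vwpDual_seven_contiguity' (b : ℕ → ℤ) (h0 : 0 ≤ b 0)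
    (hb : ∀ j ∈ Icc 1 7, 0 ≤ b j ∧ b j ≤ b 0) (hsum : ∑ j ∈ Icc 1 7, b j ≤ 3 * b 0)
    {j k : ℕ} (hj : j ∈ Icc 1 7) (hk : k ∈ Icc 1 7) :
    vwpDual 7 (Function.update b j (b j + 1)) - vwpDual 7 (Function.update b k (b k + 1)) =
      (((b j - b k) * (b 0 - b j - b k)) : ℤ) * vwpDual 7 b := by
  have hIcc : ∑ j ∈ Icc 1 7, b j = ∑ j ∈ range 7, b (j + 1) := by
    rw [range_eq_Ico, sum_Ico_add' b 0 7 1]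
    rfl
  obtain ⟨i, rfl⟩ : ∃ i, j = i + 1 := ⟨j - 1, by have := (mem_Icc.1 hj).1; omega⟩
  obtain ⟨l, rfl⟩ : ∃ l, k = l + 1 := ⟨k - 1, by have := (mem_Icc.1 hk).1; omega⟩
  have hi : i ∈ range 7 := by have := (mem_Icc.1 hj).2; exact mem_range.2 (by omega)
  have hl : l ∈ range 7 := by have := (mem_Icc.1 hk).2; exact mem_range.2 (by omega)
  have hb' : ∀ j ∈ range 7, 0 ≤ b (j + 1) ∧ b (j + 1) ≤ b 0 := fun j hj' =>
    hb (j + 1) (by have := mem_range.1 hj'; exact mem_Icc.2 ⟨by omega, by omega⟩)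
  exact vwpDual_seven_contiguity b h0 hb' (by rw [← hIcc]; exact hsum) hi hl

end Summit.KontsevichZagierPeriods.Zeta5Search.DualSeries
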